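import Summits.ResolutionOfSingularities.ResolutionOfSingularities.Theorems.JumpCutClasses
import Summits.ResolutionOfSingularities.ResolutionOfSingularities.Theorems.ProximityCutOrigin
import HarnessLib

/-!
# JumpCutPlateaux — §4 of lens-3 g13 «JumpCut» rev 2 (sha256 0a503d388e12867c; decomp-res node N70, critic row
89 MAP delta (b)(c))

BENEATH THE EQUIVALENCE `31770 ⟺ NoPlateauWalksDeep` (`NoJump.defectDeep_iff_noPlateau`), VERBATIM: the plateau
class splits by the boundary
(lens-3 g11: `NoSatellitePlateauxDeep`, `satDeep_iff_satPlateau`, `noPlateau_iff_critical_sat`) and by the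
translations (lens-3 g12:
`NoOriginTails`, IMPORTED from the landed `Theorems.ProximityCutOrigin` where it is PROVED, `noOriginTails_holds`);
the residual column is
ITINERARY-FREE: `NoSubcriticalPlateauxDeep` (`satPlateau_iff_subcritical`), and THE ONE RESIDUAL booked by the cell
after g13/g14 is
`NoRecurrentSatellitePlateauxDeep` ≡ `NoRecurrentSubcriticalPlateauxDeep` («subcritical plateau ∧
satellite-recurrent ∧ translation-recurrent»):
`defectDeep_iff_recSatPlateau` / `defectDeep_iff_recSubcritical` (mod `NoOriginTails` + BoundaryLedger's
`NoCriticalFreePlateauxDeep`),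
`defectWalksDeep_of_pieces` / `defectWalksDeep_of_subcritical_pieces` : … → `MaxContactCut.DefectWalksDeep` BY
NAME.  [WRITER NOTE (decomp-res
writer g5): verbatim; the lens's restated `NoOriginTails` def is replaced by the import (byte-identical body); two
writer corollaries at the
end discharge `hO` by `ProximityCut.noOriginTails_holds`.]  (Sources: Hauser2010 §§F–G; HauserPerlega2019 §3;
CossartPiltant2019.)
-/

open MvPolynomial Finset
open Literature.AlgebraicGeometry.Resolution
open Literature.AlgebraicGeometry.Resolution.Hauser2010
open Literature.AlgebraicGeometry.Resolution.PointBlowup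
open Summit.ResolutionOfSingularities.ResolutionOfSingularities.Theses
open Summit.ResolutionOfSingularities.ResolutionOfSingularities.Theorems.TightDefectClasses
open Summit.ResolutionOfSingularities.ResolutionOfSingularities.Theorems.TightDefectStrongWalks
open Summit.ResolutionOfSingularities.ResolutionOfSingularities.Theorems.ItineraryCutClasses
open Summit.ResolutionOfSingularities.ResolutionOfSingularities.Theorems.BoundaryLedger
open Summit.ResolutionOfSingularities.ResolutionOfSingularities.Theorems.NoJump
open Summit.ResolutionOfSingularities.ResolutionOfSingularities.Theorems.ProximityCut (NoOriginTails noOriginTails_holds)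

namespace Summit.ResolutionOfSingularities.ResolutionOfSingularities.Theorems.JumpCut

/-! ## §4 Beneath the equivalence: the plateau splits by the boundary (g11) and by the translations (g12) -/

/-- **`NoSatellitePlateauxDeep`** — no infinite forced deep walk (`e ≥ 2`, positive shade) whose shade is
eventually constant AND which makes satellite moves at infinitely many times.
[UNDECIDED · WEAKER (`satPlateau_of_deep`) · = g11's satellite column `SatDefectWalksTerminateDeep` EXACTLY
(`satDeep_iff_satPlateau`, since no walk jumps) · THE located residual of the E-format deep column] -/
def NoSatellitePlateauxDeep : Prop :=
  ∀ p : ℕ, p.Prime → ∀ e : ℕ, 2 ≤ e → ∀ (K : Type) [Field K] [CharP K p] [PerfectField K] [DecidableEq K]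
    (s₀ : State (Fin 3) K), IsRoot (p ^ e) s₀ → ∀ W : ForcedWalk (p ^ e) s₀, (∀ i, 1 ≤ (W.st i).shade) →
    EventuallyStalls (fun i => (W.st i).shade) → (∀ N : ℕ, ∃ i, N ≤ i ∧ W.Satellite i) → False

/-- Necessity from the blocker. [folklore] -/
theorem satPlateau_of_deep (h : DefectWalksTerminateDeep) : NoSatellitePlateauxDeep :=
  fun p hp e he K _ _ _ _ s₀ hs W hpos _ _ => h p hp e he K s₀ hs W hpos

/-- g11's satellite column IS the satellite-plateau class (PROVED: no walk jumps). [folklore] -/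
theorem satDeep_iff_satPlateau : SatDefectWalksTerminateDeep ↔ NoSatellitePlateauxDeep :=
  ⟨fun h p hp e he K _ _ _ _ s₀ hs W hpos _ hS => h p hp e he K s₀ hs W hpos hS,
    fun h p hp e he K _ _ _ _ s₀ hs W hpos hS => h p hp e he K s₀ hs W hpos (shade_eventuallyStalls hp hs W) hS⟩

/-- **The plateau half splits EXACTLY along the boundary ledger (PROVED, kernel g11's `free_tail_rigid`):**
`NoPlateauWalksDeep ↔ NoCriticalFreePlateauxDeep ∧ NoSatellitePlateauxDeep` — an eventually-free plateau is a
CRITICAL free plateau (shade exactly `q`, constant mass `ρ < q`: g11's bare ∪ loaded cells). [folklore] -/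
theorem noPlateau_iff_critical_sat :
    NoPlateauWalksDeep ↔ NoCriticalFreePlateauxDeep ∧ NoSatellitePlateauxDeep := by
  refine ⟨fun h => ⟨critical_of_noPlateau h, fun p hp e he K _ _ _ _ s₀ hs W hpos hS _ =>
    h p hp e he K s₀ hs W hpos hS⟩, fun ⟨h₁, h₂⟩ p hp e he K _ _ _ _ s₀ hs W hpos hS => ?_⟩
  by_cases hsat : ∀ N : ℕ, ∃ i, N ≤ i ∧ W.Satellite i
  · exact h₂ p hp e he K s₀ hs W hpos hS hsat
  · push Not at hsat
    obtain ⟨N, hN⟩ := hsat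
    obtain ⟨N₁, ρ, -, hrig⟩ := free_tail_rigid hp hs W ⟨N, fun t ht => hN t ht⟩
    exact h₁ p hp e he K s₀ hs W hpos N₁ ρ fun t ht => ⟨(hrig t ht).1, (hrig t ht).2.1, (hrig t ht).2.2.1⟩

/-- **The deep blocker after g13 (PROVED): `DefectWalksTerminateDeep ↔ NoCriticalFreePlateauxDeep ∧
NoSatellitePlateauxDeep`** — g11's grid with its jump row deleted. [folklore] -/
theorem defectDeep_iff_critical_satPlateau :
    DefectWalksTerminateDeep ↔ NoCriticalFreePlateauxDeep ∧ NoSatellitePlateauxDeep :=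
  defectDeep_iff_noPlateau.trans noPlateau_iff_critical_sat

/-! ### The residual column is ITINERARY-FREE: subcritical plateaux -/

/-- **`NoSubcriticalPlateauxDeep`** — no infinite forced deep walk (`q = pᵉ`, `e ≥ 2`) whose shade is eventually a
CONSTANT `s` with `1 ≤ s < q`.  No itinerary word (satellite / free / chart) occurs: by the height dichotomy
`satellite_io_iff_plateau_lt` this IS the satellite-plateau class (`satPlateau_iff_subcritical`).
[UNDECIDED · WEAKER (`subcritical_of_deep`) · ≡ `NoSatellitePlateauxDeep` ≡ g11 `SatDefectWalksTerminateDeep`] -/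
def NoSubcriticalPlateauxDeep : Prop :=
  ∀ p : ℕ, p.Prime → ∀ e : ℕ, 2 ≤ e → ∀ (K : Type) [Field K] [CharP K p] [PerfectField K] [DecidableEq K]
    (s₀ : State (Fin 3) K), IsRoot (p ^ e) s₀ → ∀ W : ForcedWalk (p ^ e) s₀,
    ∀ N s : ℕ, 1 ≤ s → s < p ^ e → (∀ t, N ≤ t → (W.st t).shade = (s : ℕ∞)) → False

/-- Necessity from the blocker. [folklore] -/
theorem subcritical_of_deep (h : DefectWalksTerminateDeep) : NoSubcriticalPlateauxDeep :=
  fun p hp e he K _ _ _ _ s₀ hs W _ _ h1 _ hplat => h p hp e he K s₀ hs W (one_le_shade_of_plateau hp hs W hplat h1)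

/-- **The satellite-plateau class IS the subcritical-plateau class (PROVED).** [folklore] -/
theorem satPlateau_iff_subcritical : NoSatellitePlateauxDeep ↔ NoSubcriticalPlateauxDeep := by
  refine ⟨fun h p hp e he K _ _ _ _ s₀ hs W N s h1 hsq hplat => ?_,
    fun h p hp e he K _ _ _ _ s₀ hs W hpos _ hsat => ?_⟩
  · exact h p hp e he K s₀ hs W (one_le_shade_of_plateau hp hs W hplat h1) ⟨N, fun t ht => by
      simp only; rw [hplat (t + 1) (by omega), hplat t ht]⟩ (satellite_io_of_plateau_lt hp hs W hplat hsq)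
  · obtain ⟨N, s, h1, hsq, hplat⟩ := residual_profile hp hs W hpos hsat
    exact h p hp e he K s₀ hs W N s h1 hsq hplat

/-- **The deep blocker as a HEIGHT DICHOTOMY (PROVED):** `DefectWalksTerminateDeep ↔ NoCriticalFreePlateauxDeep ∧
NoSubcriticalPlateauxDeep` — critical height `q` (free tails: g11's bare [KNOWN-MOD-PORT] ∪ loaded [desk-DECIDED g12]
lines) versus subcritical heights `1 … q−1` (THE residual column). [folklore] -/
theorem defectDeep_iff_critical_subcritical :
    DefectWalksTerminateDeep ↔ NoCriticalFreePlateauxDeep ∧ NoSubcriticalPlateauxDeep :=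
  defectDeep_iff_critical_satPlateau.trans (and_congr_right fun _ => satPlateau_iff_subcritical)

/-- **`NoRecurrentSubcriticalPlateauxDeep`** — the itinerary-light form of THE ONE RESIDUAL: no infinite forced deep
walk with shade eventually a constant `s ∈ [1, q−1]` which makes TRANSLATED moves (`b_t ≠ 0`) at infinitely many
times. [UNDECIDED · WEAKER (`recSubcritical_of_deep`) · ≡ 31770 modulo `NoOriginTails` (DECIDED g12) and
`NoCriticalFreePlateauxDeep` (port / desk-decided) by `defectDeep_iff_recSubcritical`] -/
def NoRecurrentSubcriticalPlateauxDeep : Prop :=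
  ∀ p : ℕ, p.Prime → ∀ e : ℕ, 2 ≤ e → ∀ (K : Type) [Field K] [CharP K p] [PerfectField K] [DecidableEq K]
    (s₀ : State (Fin 3) K), IsRoot (p ^ e) s₀ → ∀ W : ForcedWalk (p ^ e) s₀,
    ∀ N s : ℕ, 1 ≤ s → s < p ^ e → (∀ t, N ≤ t → (W.st t).shade = (s : ℕ∞)) →
    (∀ M : ℕ, ∃ i, M ≤ i ∧ W.b i ≠ 0) → False

/-- Necessity from the blocker. [folklore] -/
theorem recSubcritical_of_deep (h : DefectWalksTerminateDeep) : NoRecurrentSubcriticalPlateauxDeep :=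
  fun p hp e he K _ _ _ _ s₀ hs W N s h1 hsq hplat _ => subcritical_of_deep h p hp e he K s₀ hs W N s h1 hsq hplat

/-- **`NoRecurrentSatellitePlateauxDeep`** — THE ONE RESIDUAL booked by the cell after g13 (jointly with lens-5
g14's translation-recurrent class): no infinite forced deep walk (`e ≥ 2`) with positive, eventually constant
shade which makes satellite moves at infinitely many times AND translated moves (`b_t ≠ 0`) at infinitely many
times. [UNDECIDED · WEAKER (`recSatPlateau_of_deep`) · ≡ 31770 modulo `NoOriginTails` (DECIDED g12) by
`defectDeep_iff_recSatPlateau`] -/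
def NoRecurrentSatellitePlateauxDeep : Prop :=
  ∀ p : ℕ, p.Prime → ∀ e : ℕ, 2 ≤ e → ∀ (K : Type) [Field K] [CharP K p] [PerfectField K] [DecidableEq K]
    (s₀ : State (Fin 3) K), IsRoot (p ^ e) s₀ → ∀ W : ForcedWalk (p ^ e) s₀, (∀ i, 1 ≤ (W.st i).shade) →
    EventuallyStalls (fun i => (W.st i).shade) → (∀ N : ℕ, ∃ i, N ≤ i ∧ W.Satellite i) →
    (∀ N : ℕ, ∃ i, N ≤ i ∧ W.b i ≠ 0) → False

/-- Necessity from the blocker. [folklore] -/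
theorem recSatPlateau_of_deep (h : DefectWalksTerminateDeep) : NoRecurrentSatellitePlateauxDeep :=
  fun p hp e he K _ _ _ _ s₀ hs W hpos _ _ _ => h p hp e he K s₀ hs W hpos

/-- Modulo g12's `NoOriginTails` the satellite-plateau class is the translation-recurrent one. [folklore] -/
theorem satPlateau_iff_recSatPlateau (hO : NoOriginTails) :
    NoSatellitePlateauxDeep ↔ NoRecurrentSatellitePlateauxDeep := by
  refine ⟨fun h p hp e he K _ _ _ _ s₀ hs W hpos hS hsat _ => h p hp e he K s₀ hs W hpos hS hsat,
    fun h p hp e he K _ _ _ _ s₀ hs W hpos hS hsat => ?_⟩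
  by_cases htr : ∀ N : ℕ, ∃ i, N ≤ i ∧ W.b i ≠ 0
  · exact h p hp e he K s₀ hs W hpos hS hsat htr
  · push Not at htr
    obtain ⟨N, hN⟩ := htr
    exact hO p hp e (one_le_two.trans he) K s₀ hs W N hN

/-- **31770 ≡ the one residual, modulo the DECIDED pieces (PROVED glue):**
`NoOriginTails → NoCriticalFreePlateauxDeep → (DefectWalksTerminateDeep ↔ NoRecurrentSatellitePlateauxDeep)`.
(`NoCriticalFreePlateauxDeep` = g11's bare [KNOWN-MOD-PORT `BareTailPort`] ∪ loaded [desk-DECIDED by g12's arc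
law] cells.) [folklore] -/
theorem defectDeep_iff_recSatPlateau (hO : NoOriginTails) (hC : NoCriticalFreePlateauxDeep) :
    DefectWalksTerminateDeep ↔ NoRecurrentSatellitePlateauxDeep :=
  ⟨recSatPlateau_of_deep, fun h => defectDeep_iff_critical_satPlateau.mpr
    ⟨hC, (satPlateau_iff_recSatPlateau hO).mpr h⟩⟩

open Summit.ResolutionOfSingularities.ResolutionOfSingularities.Theses in
/-- The MaxContactCut aside 31770 from the residual and the decided pieces, BY NAME. [folklore] -/
theorem defectWalksDeep_of_pieces (hO : NoOriginTails) (hC : NoCriticalFreePlateauxDeep)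
    (hR : NoRecurrentSatellitePlateauxDeep) : MaxContactCut.DefectWalksDeep :=
  MaxContactCutTightDefect.defectWalksDeep_iff.mpr ((defectDeep_iff_recSatPlateau hO hC).mpr hR)

/-- Modulo g12's `NoOriginTails` the subcritical class is the translation-recurrent subcritical class. [folklore] -/
theorem subcritical_iff_recSubcritical (hO : NoOriginTails) :
    NoSubcriticalPlateauxDeep ↔ NoRecurrentSubcriticalPlateauxDeep := by
  refine ⟨fun h p hp e he K _ _ _ _ s₀ hs W N s h1 hsq hplat _ => h p hp e he K s₀ hs W N s h1 hsq hplat,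
    fun h p hp e he K _ _ _ _ s₀ hs W N s h1 hsq hplat => ?_⟩
  by_cases htr : ∀ M : ℕ, ∃ i, M ≤ i ∧ W.b i ≠ 0
  · exact h p hp e he K s₀ hs W N s h1 hsq hplat htr
  · push Not at htr
    obtain ⟨M, hM⟩ := htr
    exact hO p hp e (one_le_two.trans he) K s₀ hs W M hM

/-- **31770 ≡ the itinerary-light residual, modulo the DECIDED / ported pieces (PROVED glue):**
`NoOriginTails → NoCriticalFreePlateauxDeep → (DefectWalksTerminateDeep ↔ NoRecurrentSubcriticalPlateauxDeep)`.
[folklore] -/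
theorem defectDeep_iff_recSubcritical (hO : NoOriginTails) (hC : NoCriticalFreePlateauxDeep) :
    DefectWalksTerminateDeep ↔ NoRecurrentSubcriticalPlateauxDeep :=
  ⟨recSubcritical_of_deep, fun h => defectDeep_iff_critical_subcritical.mpr
    ⟨hC, (subcritical_iff_recSubcritical hO).mpr h⟩⟩

open Summit.ResolutionOfSingularities.ResolutionOfSingularities.Theses in
/-- The MaxContactCut aside 31770 from the itinerary-light residual and the decided pieces, BY NAME. [folklore] -/
theorem defectWalksDeep_of_subcritical_pieces (hO : NoOriginTails) (hC : NoCriticalFreePlateauxDeep)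
    (hR : NoRecurrentSubcriticalPlateauxDeep) : MaxContactCut.DefectWalksDeep :=
  MaxContactCutTightDefect.defectWalksDeep_iff.mpr ((defectDeep_iff_recSubcritical hO hC).mpr hR)


/-! ### Writer corollaries: `hO` discharged by the landed `ProximityCut.noOriginTails_holds` -/

/-- 31770 (tree class) ⟺ the one residual `NoRecurrentSubcriticalPlateauxDeep`, modulo BoundaryLedger's
`NoCriticalFreePlateauxDeep` only
(`NoOriginTails` is a theorem: `ProximityCut.noOriginTails_holds`). [folklore] -/
theorem defectDeep_iff_recSubcritical_of_tree (hC : NoCriticalFreePlateauxDeep) :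
    DefectWalksTerminateDeep ↔ NoRecurrentSubcriticalPlateauxDeep :=
  defectDeep_iff_recSubcritical ProximityCut.noOriginTails_holds hC

/-- The host item 31770 `MaxContactCut.DefectWalksDeep` from BoundaryLedger's `NoCriticalFreePlateauxDeep` and the one residual
`NoRecurrentSubcriticalPlateauxDeep` (`NoOriginTails` discharged). [folklore] -/
theorem defectWalksDeep_of_tree_pieces (hC : NoCriticalFreePlateauxDeep) (hR : NoRecurrentSubcriticalPlateauxDeep) :
    MaxContactCut.DefectWalksDeep :=
  defectWalksDeep_of_subcritical_pieces ProximityCut.noOriginTails_holds hC hR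

end Summit.ResolutionOfSingularities.ResolutionOfSingularities.Theorems.JumpCut
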